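import Summits.ValiantsHypothesis.ValiantsHypothesis.Theorems.LacunarySymmetroidMatrixDescartesCensusDoorA34Lift
import Summits.ValiantsHypothesis.ValiantsHypothesis.Theorems.LacunarySymmetroidMatrixDescartesCensusDoorA34NullNullSeventeenAnatomy

/-!
# `MatrixDescartes` census — DOOR A at `(3,4)`: the A′ BRIDGE ON THE TWO SHEETS (multiplicity / sign-variation currency)

HONEST FRAMING.  Object-search cell `pub-symmetroid`, engine seat `val-sym-eng-2` (g13); helper row beside the registered strata line
`Cruxes/DoorA34/Lines/strata.lean` on stmt-ValiantsHypothesis-19980 (`DoorA34 = PosRootLawAt 3 4 18`: OPEN, typed, never asserted here), stubs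
`stub_nullTopCeiling` (`det S₃ = 0 ⇒ ≤ 17`) and `stub_nullNullCeiling` (`det S₀ = det S₃ = 0 ⇒ ≤ 16`).  The tree's A′ BRIDGE (…CensusDoorA34Lift,
`exists_nineteen_of_eighteen_of_countP`: on the full door, 18 distinct + 19 with multiplicity ⇒ a nineteen, by the three-order deformation of one letter and
the class-level splitting theorem `exists_card_posRoots_of_double_root_deformation`) is carried here ONE AND TWO LEVELS DOWN, with the SAME proof:

* `exists_succ_of_countP_in_class` — the A′-bridge deformation step for an ARBITRARY letter `l₀` and an arbitrary class `P` of determinants closed under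
  `S_{l₀} ↦ S_{l₀} + ε·T` (`T` symmetric): `n` distinct + `n + 1` with multiplicity ⇒ a member of `P` with `n + 1` distinct positive roots.
* ★ `exists_eighteen_on_sheet_of_seventeen_of_countP` — NULL-TOP SHEET (`det S₃ = 0`, `≤ 19` monomials by `card_support_le_19_of_nullTop`): 17 distinct +
  18 with multiplicity ⇒ a symmetric pencil ON THE SHEET (same `d`) with `≥ 18` distinct positive roots (deform `S₀`); `…_of_signVariations` (`Var ≥ 18`).
* ★ `exists_seventeen_on_nullNull_of_sixteen_of_countP` — NULL-NULL SHEET (`det S₀ = det S₃ = 0`, `≤ 18` monomials by `card_support_le_18_of_nullNull`):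
  16 distinct + 17 with multiplicity ⇒ a symmetric pencil on the null-null sheet with `≥ 17` (deform the MIDDLE letter `S₁`, so both end letters survive);
  `…_of_signVariations` (`Var ≥ 17`).
* READINGS under the stubs taken as HYPOTHESES on the support (inline, never asserted): `countP_le_17_of_nullTopLawOn` / `signVariations_le_17_of_nullTopLawOn`
  — if every symmetric null-top pencil on `d` has `≤ 17`, then a null-top SEVENTEEN on `d` has only simple positive roots and is NOT fully alternating
  (`Var ≤ 17`); `countP_le_16_of_nullNullLawOn` / `signVariations_le_16_of_nullNullLawOn` likewise one level down.

LOCATED (report HOME/DOOR-A34-ENG2G13-REPORT.md): every null-top record of the tree has `Var = Z₊` (NullTopSeventeen: 17 = 17), and projecting the rail's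
pseudo-nineteens onto the sheet gives `Var = 18` words with only `8…14` roots — consistent with the reading.  Nothing here bounds any count; `DoorA34` and
all three stubs stay OPEN; registers unchanged (`ζ_sym(3,4) ∈ {18,19}`); nothing on `MatrixDescartes` (stmt-ValiantsHypothesis-18050) or `VP ≠ VNP` —
VP≠VNP not moved.  [folklore] Descartes' rule with parity; transversal splitting of a double root (tree); no citation is needed.
-/

-- `Summit.ValiantsHypothesis.ValiantsHypothesis.…` repeats a component by the D-0017 layout
-- (single-conjunct summit), which the `dupNamespace` linter flags; the name is mandated.
set_option linter.dupNamespace false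

namespace Summit.ValiantsHypothesis.ValiantsHypothesis.Theorems.LacunarySymmetroidMatrixDescartes.Census

open Polynomial Finset Filter
open scoped BigOperators Polynomial Matrix Topology
open Summit.ValiantsHypothesis.ValiantsHypothesis.Theorems.MatrixDescartes.Negative (PosRootLawAt)
open Summit.ValiantsHypothesis.ValiantsHypothesis.Theorems.SymmetroidDescartes (eval_det_pencil)

/-! ## The deformation step for an arbitrary letter and an arbitrary class -/

/-- The deformed letter family `S' l = S l + [l = l₀]·E` evaluates to `F(x) + x^{d l₀}·E`. [folklore] -/
theorem sum_smul_perturb_three_letter (l₀ : Fin 4) (d : Fin 4 → ℕ) (S : Fin 4 → Matrix (Fin 3) (Fin 3) ℝ)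
    (E : Matrix (Fin 3) (Fin 3) ℝ) (x : ℝ) :
    (∑ l, x ^ d l • (S l + if l = l₀ then E else 0)) = (∑ l, x ^ d l • S l) + x ^ d l₀ • E := by
  have h : ∀ l : Fin 4, x ^ d l • (S l + if l = l₀ then E else 0)
      = x ^ d l • S l + (if l = l₀ then x ^ d l₀ • E else 0) := by
    intro l
    split_ifs with hl
    · subst hl; rw [smul_add]
    · rw [add_zero, add_zero]
  simp_rw [h, Finset.sum_add_distrib, Finset.sum_ite_eq', Finset.mem_univ, if_true]

/-- **The A′-bridge step inside a class, through letter `l₀`.**  Let `P` be a class of real polynomials containing `f = det(Σ X^{d l} S_l)` (`S_l` symmetric)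
and closed under the deformations `S_{l₀} ↦ S_{l₀} + ε·T` (`T` symmetric).  If `f` has `≥ n` distinct positive roots and exactly `n + 1` counted with
multiplicity, some member of `P` has `≥ n + 1` distinct positive roots.  (Proof = the tree's A′ bridge with `d 0` replaced by `d l₀`.) [folklore] -/
theorem exists_succ_of_countP_in_class (l₀ : Fin 4) (d : Fin 4 → ℕ) (S : Fin 4 → Matrix (Fin 3) (Fin 3) ℝ) (hS : ∀ l, (S l).IsSymm)
    (P : ℝ[X] → Prop) {f : ℝ[X]} (hf : f = ((∑ l, (X : ℝ[X]) ^ d l • (S l).map C)).det) (hPf : P f)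
    (hP : ∀ T : Matrix (Fin 3) (Fin 3) ℝ, T.IsSymm → ∀ ε : ℝ,
      P ((∑ l, (X : ℝ[X]) ^ d l • (S l + if l = l₀ then ε • T else 0).map C)).det)
    (n : ℕ) (hZ : n ≤ (f.roots.toFinset.filter (fun t => 0 < t)).card) (hZm : f.roots.countP (fun t => 0 < t) = n + 1) :
    ∃ f' : ℝ[X], P f' ∧ n + 1 ≤ (f'.roots.toFinset.filter (fun t => 0 < t)).card := by
  classical
  have hf0 : f ≠ 0 := by rintro rfl; simp at hZm
  refine exists_card_posRoots_of_double_root_deformation P f n hPf hZ hZm ?_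
  intro r hr hm σ hσ
  have hfr : f.eval r = 0 := ((rootMultiplicity_pos hf0).mp (by omega)).eq_zero
  let A : ℝ → Matrix (Fin 3) (Fin 3) ℝ := fun x => ∑ l, x ^ d l • S l
  have hfA : ∀ x, f.eval x = (A x).det := fun x => by rw [hf]; exact eval_det_pencil S d x
  have hAsymm : ∀ x, (A x).IsSymm := by
    intro x
    show (∑ l, x ^ d l • S l).IsSymm
    unfold Matrix.IsSymm
    rw [Matrix.transpose_sum]
    exact Finset.sum_congr rfl fun l _ => by rw [Matrix.transpose_smul, hS l]
  let Sp : Matrix (Fin 3) (Fin 3) ℝ → ℝ → Fin 4 → Matrix (Fin 3) (Fin 3) ℝ :=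
    fun T ε l => S l + if l = l₀ then ε • T else 0
  let g : Matrix (Fin 3) (Fin 3) ℝ → ℝ → ℝ[X] := fun T ε => ((∑ l, (X : ℝ[X]) ^ d l • (Sp T ε l).map C)).det
  have hg_eval : ∀ T ε x, (g T ε).eval x = f.eval x + (ε * x ^ d l₀) * ((A x).adjugate * T).trace
      + (ε * x ^ d l₀) ^ 2 * (T.adjugate * A x).trace + (ε * x ^ d l₀) ^ 3 * T.det := by
    intro T ε x
    show (((∑ l, (X : ℝ[X]) ^ d l • (Sp T ε l).map C)).det).eval x = _
    rw [eval_det_pencil (Sp T ε) d x, hfA x]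
    show (∑ l, x ^ d l • (S l + if l = l₀ then ε • T else 0)).det = _
    rw [sum_smul_perturb_three_letter, smul_smul, mul_comm (x ^ d l₀) ε]
    exact det_add_smul_fin_three (A x) T (ε * x ^ d l₀)
  have hgP : ∀ T, T.IsSymm → ∀ ε, P (g T ε) := fun T hT ε => hP T hT ε
  have hglim : ∀ T x, Tendsto (fun ε => (g T ε).eval x) (𝓝[>] 0) (𝓝 (f.eval x)) := by
    intro T x
    simp_rw [hg_eval T]
    have hc : Continuous (fun ε : ℝ => f.eval x + (ε * x ^ d l₀) * ((A x).adjugate * T).trace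
        + (ε * x ^ d l₀) ^ 2 * (T.adjugate * A x).trace + (ε * x ^ d l₀) ^ 3 * T.det) := by
      fun_prop
    have := hc.tendsto 0
    simp only [zero_mul, ne_eq, OfNat.ofNat_ne_zero, not_false_eq_true, zero_pow, add_zero] at this
    exact this.mono_left nhdsWithin_le_nhds
  suffices hT : ∃ T : Matrix (Fin 3) (Fin 3) ℝ, T.IsSymm ∧
      ∀ᶠ ε in 𝓝[>] (0 : ℝ), ((ε * r ^ d l₀) * ((A r).adjugate * T).trace
        + (ε * r ^ d l₀) ^ 2 * (T.adjugate * A r).trace + (ε * r ^ d l₀) ^ 3 * T.det) * σ < 0 by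
    obtain ⟨T, hT, hTr⟩ := hT
    refine ⟨g T, hgP T hT, hglim T, ?_⟩
    filter_upwards [hTr] with ε hε
    rwa [hg_eval, hfr, zero_add]
  have hc0 : 0 < r ^ d l₀ := pow_pos hr _
  have lead : ∀ (L : ℝ) (M : ℝ → ℝ), Continuous M → L < 0 → ∀ j : ℕ,
      ∀ᶠ ε in 𝓝[>] (0 : ℝ), ε ^ j * (L + ε * M ε) < 0 := by
    intro L M hM hL j
    have hlim : Tendsto (fun ε : ℝ => L + ε * M ε) (𝓝[>] 0) (𝓝 (L + 0 * M 0)) := by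
      refine Filter.Tendsto.mono_left ?_ nhdsWithin_le_nhds
      exact tendsto_const_nhds.add ((continuous_id.mul hM).tendsto 0)
    rw [zero_mul, add_zero] at hlim
    have hev := hlim.eventually (gt_mem_nhds hL)
    filter_upwards [hev, self_mem_nhdsWithin] with ε hε (hε0 : 0 < ε)
    exact mul_neg_of_pos_of_neg (pow_pos hε0 j) hε
  by_cases hadj : (A r).adjugate = 0
  · by_cases hA : A r = 0
    · refine ⟨Matrix.diagonal ![1, 1, -σ], Matrix.isSymm_diagonal _, ?_⟩
      have hdet : (Matrix.diagonal ![(1 : ℝ), 1, -σ]).det = -σ := by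
        rw [Matrix.det_diagonal]; simp [Fin.prod_univ_three]
      have key : ∀ ε : ℝ, ((ε * r ^ d l₀) * ((A r).adjugate * Matrix.diagonal ![(1 : ℝ), 1, -σ]).trace
          + (ε * r ^ d l₀) ^ 2 * ((Matrix.diagonal ![(1 : ℝ), 1, -σ]).adjugate * A r).trace
          + (ε * r ^ d l₀) ^ 3 * (Matrix.diagonal ![(1 : ℝ), 1, -σ]).det) * σ
          = ε ^ 3 * (-(r ^ d l₀) ^ 3 * σ ^ 2 + ε * 0) := by
        intro ε; rw [hadj, hA, hdet]; simp; ring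
      simp_rw [key]
      refine lead _ (fun _ => 0) continuous_const ?_ 3
      have : 0 < (r ^ d l₀) ^ 3 * σ ^ 2 := by positivity
      linarith
    · obtain ⟨i, hi⟩ := exists_diag_ne_zero_of_adjugate_eq_zero (hAsymm r) hadj hA
      refine ⟨(Matrix.diagonal fun m : Fin 3 => if m = i then (0 : ℝ) else if m = i + 1 then 1 else (-σ * (A r) i i)), Matrix.isSymm_diagonal _, ?_⟩
      have key : ∀ ε : ℝ, ((ε * r ^ d l₀) * ((A r).adjugate * (Matrix.diagonal fun m : Fin 3 => if m = i then (0 : ℝ) else if m = i + 1 then 1 else (-σ * (A r) i i))).trace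
          + (ε * r ^ d l₀) ^ 2 * (((Matrix.diagonal fun m : Fin 3 => if m = i then (0 : ℝ) else if m = i + 1 then 1 else (-σ * (A r) i i))).adjugate * A r).trace
          + (ε * r ^ d l₀) ^ 3 * ((Matrix.diagonal fun m : Fin 3 => if m = i then (0 : ℝ) else if m = i + 1 then 1 else (-σ * (A r) i i))).det) * σ
          = ε ^ 2 * (-((r ^ d l₀) ^ 2 * (σ * (A r) i i) ^ 2)
              + ε * ((r ^ d l₀) ^ 3 * ((Matrix.diagonal fun m : Fin 3 => if m = i then (0 : ℝ) else if m = i + 1 then 1 else (-σ * (A r) i i))).det * σ)) := by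
        intro ε; rw [hadj, trace_adjugate_diagonal_three_mul]; simp; ring
      simp_rw [key]
      refine lead _ (fun _ => (r ^ d l₀) ^ 3 * ((Matrix.diagonal fun m : Fin 3 => if m = i then (0 : ℝ) else if m = i + 1 then 1 else (-σ * (A r) i i))).det * σ) continuous_const ?_ 2
      have h1 : 0 < (σ * (A r) i i) ^ 2 := by have := mul_ne_zero hσ hi; positivity
      have : 0 < (r ^ d l₀) ^ 2 * (σ * (A r) i i) ^ 2 := by positivity
      linarith
  · have hsymadj : (A r).adjugate.IsSymm := (hAsymm r).adjugate
    refine ⟨(-σ) • (A r).adjugate, hsymadj.smul _, ?_⟩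
    have hpos : 0 < ((A r).adjugate * (A r).adjugate).trace := trace_mul_self_pos_of_isSymm hsymadj hadj
    set Tm := (-σ) • (A r).adjugate with hTm
    have htr : ((A r).adjugate * Tm).trace = -σ * ((A r).adjugate * (A r).adjugate).trace := by
      rw [hTm, Matrix.mul_smul, Matrix.trace_smul, smul_eq_mul]
    have key : ∀ ε : ℝ, ((ε * r ^ d l₀) * ((A r).adjugate * Tm).trace
        + (ε * r ^ d l₀) ^ 2 * (Tm.adjugate * A r).trace + (ε * r ^ d l₀) ^ 3 * Tm.det) * σ
        = ε ^ 1 * (-(r ^ d l₀ * σ ^ 2 * ((A r).adjugate * (A r).adjugate).trace)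
            + ε * ((r ^ d l₀) ^ 2 * (Tm.adjugate * A r).trace * σ + ε * ((r ^ d l₀) ^ 3 * Tm.det * σ))) := by
      intro ε; rw [htr]; ring
    simp_rw [key]
    refine lead _ (fun ε => (r ^ d l₀) ^ 2 * (Tm.adjugate * A r).trace * σ + ε * ((r ^ d l₀) ^ 3 * Tm.det * σ))
      (by fun_prop) ?_ 1
    have : 0 < r ^ d l₀ * σ ^ 2 * ((A r).adjugate * (A r).adjugate).trace := by
      have : 0 < σ ^ 2 := by positivity
      positivity
    linarith

/-! ## The null-top sheet -/

/-- ★ **A′ BRIDGE ON THE NULL-TOP SHEET (multiplicity form).**  `det S₃ = 0`, all letters symmetric: if the determinant has `≥ 17` distinct positive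
roots and `≥ 18` counted with multiplicity, then some real symmetric pencil on the same `d`, STILL with `det S'₃ = 0`, has `≥ 18` distinct positive
det-roots (deformation of `S₀`). [folklore] -/
theorem exists_eighteen_on_sheet_of_seventeen_of_countP (d : Fin 4 → ℕ) (S : Fin 4 → Matrix (Fin 3) (Fin 3) ℝ)
    (hS : ∀ l, (S l).IsSymm) (h3 : (S 3).det = 0) {f : ℝ[X]}
    (hf : f = ((∑ l, (X : ℝ[X]) ^ d l • (S l).map C)).det)
    (hZ : 17 ≤ (f.roots.toFinset.filter (fun t => 0 < t)).card)
    (hZm : 18 ≤ f.roots.countP (fun t => 0 < t)) :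
    ∃ S' : Fin 4 → Matrix (Fin 3) (Fin 3) ℝ, (∀ l, (S' l).IsSymm) ∧ (S' 3).det = 0 ∧
      18 ≤ ((((∑ l, (X : ℝ[X]) ^ d l • (S' l).map C)).det).roots.toFinset.filter (fun t => 0 < t)).card := by
  classical
  have hf0 : f ≠ 0 := by rintro rfl; simp at hZ
  have hZm18 : f.roots.countP (fun t => 0 < t) = 17 + 1 := by
    have h1 := f.roots_countP_pos_le_signVariations
    have h2 := Literature.Computability.AlgebraicComplexity.signVariations_lt_card_support hf0
    have h3' := card_support_le_19_of_nullTop d S h3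
    rw [← hf] at h3'
    omega
  let P : ℝ[X] → Prop := fun g => ∃ S' : Fin 4 → Matrix (Fin 3) (Fin 3) ℝ, (∀ l, (S' l).IsSymm) ∧ (S' 3).det = 0 ∧
    g = ((∑ l, (X : ℝ[X]) ^ d l • (S' l).map C)).det
  have hPf : P f := ⟨S, hS, h3, hf⟩
  have hP : ∀ T : Matrix (Fin 3) (Fin 3) ℝ, T.IsSymm → ∀ ε : ℝ,
      P ((∑ l, (X : ℝ[X]) ^ d l • (S l + if l = 0 then ε • T else 0).map C)).det := by
    intro T hT ε
    refine ⟨fun l => S l + if l = 0 then ε • T else 0, fun l => ?_, ?_, rfl⟩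
    · show (S l + if l = 0 then ε • T else 0).IsSymm
      split_ifs
      · exact (hS l).add (hT.smul ε)
      · rw [add_zero]; exact hS l
    · show (S 3 + if (3 : Fin 4) = 0 then ε • T else 0).det = 0
      rw [if_neg (by decide), add_zero, h3]
  obtain ⟨f', ⟨S', hS', h3', rfl⟩, h18⟩ := exists_succ_of_countP_in_class 0 d S hS P hf hPf hP 17 hZ hZm18
  exact ⟨S', hS', h3', h18⟩

/-- **A′ BRIDGE ON THE NULL-TOP SHEET (sign-variation form)**: `≥ 17` distinct positive roots and `Var ≥ 18` (a fully alternating 19-letter word)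
suffice. [folklore] -/
theorem exists_eighteen_on_sheet_of_seventeen_of_signVariations (d : Fin 4 → ℕ) (S : Fin 4 → Matrix (Fin 3) (Fin 3) ℝ)
    (hS : ∀ l, (S l).IsSymm) (h3 : (S 3).det = 0) {f : ℝ[X]}
    (hf : f = ((∑ l, (X : ℝ[X]) ^ d l • (S l).map C)).det)
    (hZ : 17 ≤ (f.roots.toFinset.filter (fun t => 0 < t)).card) (hV : 18 ≤ f.signVariations) :
    ∃ S' : Fin 4 → Matrix (Fin 3) (Fin 3) ℝ, (∀ l, (S' l).IsSymm) ∧ (S' 3).det = 0 ∧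
      18 ≤ ((((∑ l, (X : ℝ[X]) ^ d l • (S' l).map C)).det).roots.toFinset.filter (fun t => 0 < t)).card := by
  classical
  have hf0 : f ≠ 0 := by rintro rfl; simp at hZ
  obtain ⟨j, hj⟩ := Literature.Algebra.Polynomial.Descartes.signVariations_eq_countP_add_two_mul f
  have h2 := Literature.Computability.AlgebraicComplexity.signVariations_lt_card_support hf0
  have h3' := card_support_le_19_of_nullTop d S h3
  rw [← hf] at h3'
  have h4 : (f.roots.toFinset.filter (fun t => 0 < t)).card ≤ f.roots.countP (fun t => 0 < t) := by
    rw [← Multiset.toFinset_filter, Multiset.countP_eq_card_filter]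
    exact Multiset.toFinset_card_le _
  refine exists_eighteen_on_sheet_of_seventeen_of_countP d S hS h3 hf hZ ?_
  omega

/-- **READING under the null-top law on `d` (hypothesis, never asserted).**  If every real symmetric null-top pencil on `d` has `≤ 17` distinct positive
det-roots, then a null-top SEVENTEEN on `d` has all its positive roots SIMPLE (`≤ 17` with multiplicity) … [folklore] -/
theorem countP_le_17_of_nullTopLawOn {d : Fin 4 → ℕ}
    (hlaw : ∀ S' : Fin 4 → Matrix (Fin 3) (Fin 3) ℝ, (∀ l, (S' l).IsSymm) → (S' 3).det = 0 →
      ((((∑ l, (X : ℝ[X]) ^ d l • (S' l).map C)).det).roots.toFinset.filter (fun t => 0 < t)).card ≤ 17)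
    (S : Fin 4 → Matrix (Fin 3) (Fin 3) ℝ) (hS : ∀ l, (S l).IsSymm) (h3 : (S 3).det = 0)
    (h17 : 17 ≤ ((((∑ l, (X : ℝ[X]) ^ d l • (S l).map C)).det).roots.toFinset.filter (fun t => 0 < t)).card) :
    (((∑ l, (X : ℝ[X]) ^ d l • (S l).map C)).det).roots.countP (fun t => 0 < t) ≤ 17 := by
  by_contra h
  obtain ⟨S', hS', h3', h18⟩ := exists_eighteen_on_sheet_of_seventeen_of_countP d S hS h3 rfl h17 (by omega)
  have := hlaw S' hS' h3'
  omega

/-- … and is NOT fully alternating: `Var ≤ 17`. [folklore] -/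
theorem signVariations_le_17_of_nullTopLawOn {d : Fin 4 → ℕ}
    (hlaw : ∀ S' : Fin 4 → Matrix (Fin 3) (Fin 3) ℝ, (∀ l, (S' l).IsSymm) → (S' 3).det = 0 →
      ((((∑ l, (X : ℝ[X]) ^ d l • (S' l).map C)).det).roots.toFinset.filter (fun t => 0 < t)).card ≤ 17)
    (S : Fin 4 → Matrix (Fin 3) (Fin 3) ℝ) (hS : ∀ l, (S l).IsSymm) (h3 : (S 3).det = 0)
    (h17 : 17 ≤ ((((∑ l, (X : ℝ[X]) ^ d l • (S l).map C)).det).roots.toFinset.filter (fun t => 0 < t)).card) :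
    (((∑ l, (X : ℝ[X]) ^ d l • (S l).map C)).det).signVariations ≤ 17 := by
  by_contra h
  obtain ⟨S', hS', h3', h18⟩ := exists_eighteen_on_sheet_of_seventeen_of_signVariations d S hS h3 rfl h17 (by omega)
  have := hlaw S' hS' h3'
  omega

/-! ## The null-null sheet (deform the middle letter `S₁`) -/

/-- ★ **A′ BRIDGE ON THE NULL-NULL SHEET (multiplicity form).**  `det S₀ = det S₃ = 0`, all letters symmetric: `≥ 16` distinct positive roots and
`≥ 17` with multiplicity ⇒ some real symmetric pencil on the same `d`, STILL null-null, with `≥ 17` distinct positive det-roots (deformation of `S₁`).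
[folklore] -/
theorem exists_seventeen_on_nullNull_of_sixteen_of_countP (d : Fin 4 → ℕ) (S : Fin 4 → Matrix (Fin 3) (Fin 3) ℝ)
    (hS : ∀ l, (S l).IsSymm) (h0 : (S 0).det = 0) (h3 : (S 3).det = 0) {f : ℝ[X]}
    (hf : f = ((∑ l, (X : ℝ[X]) ^ d l • (S l).map C)).det)
    (hZ : 16 ≤ (f.roots.toFinset.filter (fun t => 0 < t)).card)
    (hZm : 17 ≤ f.roots.countP (fun t => 0 < t)) :
    ∃ S' : Fin 4 → Matrix (Fin 3) (Fin 3) ℝ, (∀ l, (S' l).IsSymm) ∧ (S' 0).det = 0 ∧ (S' 3).det = 0 ∧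
      17 ≤ ((((∑ l, (X : ℝ[X]) ^ d l • (S' l).map C)).det).roots.toFinset.filter (fun t => 0 < t)).card := by
  classical
  have hf0 : f ≠ 0 := by rintro rfl; simp at hZ
  have hZm17 : f.roots.countP (fun t => 0 < t) = 16 + 1 := by
    have h1 := f.roots_countP_pos_le_signVariations
    have h2 := Literature.Computability.AlgebraicComplexity.signVariations_lt_card_support hf0
    have h3' := card_support_le_18_of_nullNull d S h0 h3
    rw [← hf] at h3'
    omega
  let P : ℝ[X] → Prop := fun g => ∃ S' : Fin 4 → Matrix (Fin 3) (Fin 3) ℝ, (∀ l, (S' l).IsSymm) ∧ (S' 0).det = 0 ∧ (S' 3).det = 0 ∧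
    g = ((∑ l, (X : ℝ[X]) ^ d l • (S' l).map C)).det
  have hPf : P f := ⟨S, hS, h0, h3, hf⟩
  have hP : ∀ T : Matrix (Fin 3) (Fin 3) ℝ, T.IsSymm → ∀ ε : ℝ,
      P ((∑ l, (X : ℝ[X]) ^ d l • (S l + if l = 1 then ε • T else 0).map C)).det := by
    intro T hT ε
    refine ⟨fun l => S l + if l = 1 then ε • T else 0, fun l => ?_, ?_, ?_, rfl⟩
    · show (S l + if l = 1 then ε • T else 0).IsSymm
      split_ifs
      · exact (hS l).add (hT.smul ε)
      · rw [add_zero]; exact hS l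
    · show (S 0 + if (0 : Fin 4) = 1 then ε • T else 0).det = 0
      rw [if_neg (by decide), add_zero, h0]
    · show (S 3 + if (3 : Fin 4) = 1 then ε • T else 0).det = 0
      rw [if_neg (by decide), add_zero, h3]
  obtain ⟨f', ⟨S', hS', h0', h3', rfl⟩, h17⟩ := exists_succ_of_countP_in_class 1 d S hS P hf hPf hP 16 hZ hZm17
  exact ⟨S', hS', h0', h3', h17⟩

/-- **A′ BRIDGE ON THE NULL-NULL SHEET (sign-variation form)**: `≥ 16` distinct positive roots and `Var ≥ 17` suffice. [folklore] -/
theorem exists_seventeen_on_nullNull_of_sixteen_of_signVariations (d : Fin 4 → ℕ) (S : Fin 4 → Matrix (Fin 3) (Fin 3) ℝ)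
    (hS : ∀ l, (S l).IsSymm) (h0 : (S 0).det = 0) (h3 : (S 3).det = 0) {f : ℝ[X]}
    (hf : f = ((∑ l, (X : ℝ[X]) ^ d l • (S l).map C)).det)
    (hZ : 16 ≤ (f.roots.toFinset.filter (fun t => 0 < t)).card) (hV : 17 ≤ f.signVariations) :
    ∃ S' : Fin 4 → Matrix (Fin 3) (Fin 3) ℝ, (∀ l, (S' l).IsSymm) ∧ (S' 0).det = 0 ∧ (S' 3).det = 0 ∧
      17 ≤ ((((∑ l, (X : ℝ[X]) ^ d l • (S' l).map C)).det).roots.toFinset.filter (fun t => 0 < t)).card := by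
  classical
  have hf0 : f ≠ 0 := by rintro rfl; simp at hZ
  obtain ⟨j, hj⟩ := Literature.Algebra.Polynomial.Descartes.signVariations_eq_countP_add_two_mul f
  have h2 := Literature.Computability.AlgebraicComplexity.signVariations_lt_card_support hf0
  have h3' := card_support_le_18_of_nullNull d S h0 h3
  rw [← hf] at h3'
  have h4 : (f.roots.toFinset.filter (fun t => 0 < t)).card ≤ f.roots.countP (fun t => 0 < t) := by
    rw [← Multiset.toFinset_filter, Multiset.countP_eq_card_filter]
    exact Multiset.toFinset_card_le _
  refine exists_seventeen_on_nullNull_of_sixteen_of_countP d S hS h0 h3 hf hZ ?_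
  omega

/-- **READING under the null-null law on `d` (hypothesis, never asserted)**: a null-null SIXTEEN on `d` has only simple positive roots … [folklore] -/
theorem countP_le_16_of_nullNullLawOn {d : Fin 4 → ℕ}
    (hlaw : ∀ S' : Fin 4 → Matrix (Fin 3) (Fin 3) ℝ, (∀ l, (S' l).IsSymm) → (S' 0).det = 0 → (S' 3).det = 0 →
      ((((∑ l, (X : ℝ[X]) ^ d l • (S' l).map C)).det).roots.toFinset.filter (fun t => 0 < t)).card ≤ 16)
    (S : Fin 4 → Matrix (Fin 3) (Fin 3) ℝ) (hS : ∀ l, (S l).IsSymm) (h0 : (S 0).det = 0) (h3 : (S 3).det = 0)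
    (h16 : 16 ≤ ((((∑ l, (X : ℝ[X]) ^ d l • (S l).map C)).det).roots.toFinset.filter (fun t => 0 < t)).card) :
    (((∑ l, (X : ℝ[X]) ^ d l • (S l).map C)).det).roots.countP (fun t => 0 < t) ≤ 16 := by
  by_contra h
  obtain ⟨S', hS', h0', h3', h17⟩ := exists_seventeen_on_nullNull_of_sixteen_of_countP d S hS h0 h3 rfl h16 (by omega)
  have := hlaw S' hS' h0' h3'
  omega

/-- … and `Var ≤ 16`. [folklore] -/
theorem signVariations_le_16_of_nullNullLawOn {d : Fin 4 → ℕ}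
    (hlaw : ∀ S' : Fin 4 → Matrix (Fin 3) (Fin 3) ℝ, (∀ l, (S' l).IsSymm) → (S' 0).det = 0 → (S' 3).det = 0 →
      ((((∑ l, (X : ℝ[X]) ^ d l • (S' l).map C)).det).roots.toFinset.filter (fun t => 0 < t)).card ≤ 16)
    (S : Fin 4 → Matrix (Fin 3) (Fin 3) ℝ) (hS : ∀ l, (S l).IsSymm) (h0 : (S 0).det = 0) (h3 : (S 3).det = 0)
    (h16 : 16 ≤ ((((∑ l, (X : ℝ[X]) ^ d l • (S l).map C)).det).roots.toFinset.filter (fun t => 0 < t)).card) :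
    (((∑ l, (X : ℝ[X]) ^ d l • (S l).map C)).det).signVariations ≤ 16 := by
  by_contra h
  obtain ⟨S', hS', h0', h3', h17⟩ := exists_seventeen_on_nullNull_of_sixteen_of_signVariations d S hS h0 h3 rfl h16 (by omega)
  have := hlaw S' hS' h0' h3'
  omega

end Summit.ValiantsHypothesis.ValiantsHypothesis.Theorems.LacunarySymmetroidMatrixDescartes.Census
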